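/-
COR-CM (cell pub-hodgecm2, stage 2 of the Hodge ladder) — PLANNER-D «delrec», row ii-a LITE (planner HOME/INBOX l.14865; seat
prover-pub-hodgecm2-delrec-p1-g0-0): the Summits-side bridge for an END displaying
`hDel' : UnitaryCanonicalModel.canonicalModel_exists_form` (row B1 — [Deligne 1979] 2.2.5 + Cor. 2.7.21 read as «a form of `M_ℂ(G,X)`
over `E(G,X) = τ(L)` with the reciprocity law (62) at the special points» and NOTHING ELSE).  ONE THEOREM (a one-line composition of
the landed rows B1 ✔ p375397 and S1a ✔ p375099); nothing landed is edited or restated; new declaration name.  The converse and the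
`↔` are row ii-d (`DelRec/RecordSystemIffForm.lean`, after S1b).  FRAMING: HC_CM is NOT proved; nothing here discharges any displayed
hypothesis of any END.
-/
import Summits.HodgeConjecture.CorCM.DelRec.RecordSystemOfPrinted
import Literature.AlgebraicGeometry.ShimuraVarieties.UnitaryShimuraCanonicalModelPrintedForm
import HarnessLib

/-!
# [Deligne 1979] 2.2.5 + Cor. 2.7.21 read as «form over `τ(L)` + reciprocity» GIVES Deligne's record system

The tree's PACKAGED Deligne record `UnitaryCanonicalModel.exists_recordSystem` (`UnitaryShimuraCanonicalModel.lean` :411, the binder `h`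
of the ENDs of the cell) follows from the tightest printed shape `UnitaryCanonicalModel.canonicalModel_exists_form`
(`UnitaryShimuraCanonicalModelPrintedForm.lean`, row B1: at every datum and for every complex record system `Sc` = `M_ℂ(G,X)`,
`∃ (M : C5.SmallLevel K₀ ⥤ SchemeOver L) (e : (M ⋙ Motives.baseChangeHom τ) ≅ Sc.Mc), IsCanonicalDescentAt Sc M e` — no `smooth` ∕
`projective` clause):

* `exists_recordSystem_of_form` — `canonicalModel_exists_form → exists_recordSystem`: row B1's `canonicalModel_exists_printed_iff_form`
  (smoothness ∕ projectivity of the models DESCEND along `τ : L → ℂ` — Mathlib fpqc descent of `Smooth`, the tree's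
  `HodgeTheory.smoothOfRelativeDimension_hom_of_baseChangeHom` and `Motives.IsProjectiveOver.of_baseChange_holds`), then row S1a's
  `exists_recordSystem_of_printed` (`HComp.nonempty_complexRecordSystem` + `RecordSystem.nonempty_of_descent`).

So an END may display `hDel' : canonicalModel_exists_form` in place of `h : exists_recordSystem` and supply
`h := exists_recordSystem_of_form hDel'` inside (row ii-c).  HC_CM is NOT proved here or by this.

References: [Deligne1979ShimuraVarieties] 2.1.2–2.1.4, 2.2.4–2.2.5, Cor. 2.7.21; [Milne2005ShimuraVarieties] Def. 12.8 (62), Def. 12.10;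
[GortzWedhorn2020] Prop. 14.57; [EGAIV4] Prop. 17.7.4.
-/

set_option autoImplicit false

namespace Summit.HodgeConjecture.CorCM.DelRec

open Literature.AlgebraicGeometry.ShimuraVarieties.UnitaryCanonicalModel

/-- **[Deligne 1979, 2.2.5 + Cor. 2.7.21] read as «a form of `M_ℂ(G,X)` over `τ(L)` with (62)» GIVES Deligne's record system**
(`canonicalModel_exists_form → exists_recordSystem`): the two clauses absent from the «form» shape (`M_K` smooth of relative dimension
`2`, projective over `L`) are recovered by descent along `τ : L → ℂ` (row B1, `canonicalModel_exists_printed_iff_form`), then row S1a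
(`exists_recordSystem_of_printed`: a complex record system exists at every datum, `HComp.nonempty_complexRecordSystem`, and an
`L`-descent with reciprocity of it is a record system, `RecordSystem.nonempty_of_descent`).
[cite: Deligne1979ShimuraVarieties, 2.2.5 and Cor. 2.7.21 (PDF pp. 29, 52 of Milne's translation); 2.1.2–2.1.4]
[cite: Milne2005ShimuraVarieties, Def. 12.8 (62) p. 114; Def. 12.10 p. 115] [cite: GortzWedhorn2020, Prop. 14.57 (p. 571)] -/
theorem exists_recordSystem_of_form (hDel' : canonicalModel_exists_form) : exists_recordSystem :=
  exists_recordSystem_of_printed (canonicalModel_exists_printed_iff_form.mpr hDel')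

end Summit.HodgeConjecture.CorCM.DelRec
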